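import Summits.QuantumFields.YangMills.Theorems.UnitScaleTiltProp7MassiveDivergenceSupDoor
import Summits.QuantumFields.YangMills.Theorems.UnitScaleTiltProp7MassiveDivergenceAgmonRow
import HarnessLib

/-!
# Route `UnitScaleTilt`, crux K1 «MinimiserStabilityRegPr» (stmt-QuantumFields-19200), EX row (5) `h3` (STOREY H), H-ROAD pipeline (ii) H2-LOC — THE KNIT `hWsup ⟸ hHlocV`:
# **THE SUP OF THE MASSIVE RESOLVENT ON DIVERGENCE DATA AT A PRINTED-REGULAR BACKGROUND FROM THE CURVED INTERIOR η-½-HÖLDER LETTER ALONE** — the DOOR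
# ✓`Prop7MassiveDivergenceSupDoor.hWsup_of_hHlocV` (px5 g16) with its Agmon `L²` row `hArow` DISCHARGED by cst-p1 g38's ✓`Prop7MassiveDivergenceAgmonRow.sq_sum_ball_le_of_massive_divergence`
# at `C_A := 9·192³` (★CHAIR WORD №60 (4), №62; LOCATE c1d4da4e; letter texts px19 g16 `hHlocV` 857ccd79b0071bdc ∕ `hWsup` a03f6c184c689677 VERBATIM).

Cell `ym3-torus` (HUMAN RULING D-0037; rung R3 = SU(2) YM₃ on T³ — NOT d = 4, NOT infinite volume, NOT a mass gap, NOT Clay).  Width seat `ym3-torus-px5` (gen 16);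
`--supports stmt-QuantumFields-19200 --as helper`; count-neutral; THEOREMS ONLY (0 `def`, 0 `sorry`, default heartbeats).

WHAT IS PROVED (ns `Summit.QuantumFields.YangMills.Theorems.Prop7MassiveDivergenceSupKnit`): ★★★ `hWsup_of_hHlocV_agmon` — `0 ≤ Ch → 0 < θ₀ → ⟨hHlocV Ch θ₀⟩ → ∃ Cw θw, 0 ≤ Cw ∧ 0 < θw ∧
⟨hWsup Cw θw⟩`, witnesses `Cw := 2(8Ch+1)³·√(9·192³) + 1`, `θw := θ₀∕48`.  With it the `hWsup` letter of H2 FILE 2 ∕ C6 has ONE open supplier letter left: px19's (C5) `∃ Ch θ₀, …hHlocV`.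
HYP-SAT (★★OWNER RULING №42): `hHlocV` is a displayed real-inequality schema TRUE for arbitrary `V` (flat case inhabited by ✓`exists_localHolder_flat_member`); it does not restate the conclusion.
HONEST SCOPE.  A one-line composition; nothing of `hHlocV`, H2 FILE 2, `h3`, norm_G, EX, 19200 or the rung is proved; the Yang–Mills mass gap is NOT proved.

References: T. Bałaban, CMP **99** (1985) 389–434 [Balaban1985BackgroundPropagators] (Thm 3.1 (3.42)–(3.47) pp.397–399, p.399 L1–3); CMP **96** (1984) 223–250 [Balaban1984PropagatorsII]
(Lemma 2.1 (2.61)–(2.63) p.234).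
-/

set_option autoImplicit false

noncomputable section

open scoped InnerProductSpace ComplexConjugate BigOperators Matrix.Norms.L2Operator

namespace Summit.QuantumFields.YangMills.Theorems.Prop7MassiveDivergenceSupKnit

open Literature.MathematicalPhysics.QuantumFieldTheory.Balaban1983to89
open Literature.MathematicalPhysics.QuantumFieldTheory.Balaban1983to89.T3ContinuumYM3Torus
open B4Sect5Torus (TSite tdist)
open B9SectCLatticeCarrier (Bond)
open B9Eq311L2Pairing (WL2)
open B11Eq103H1Complex (SiteL2K BondL2K)
open T3PrintedRegularMinimiser (RegPr)
open Summit.QuantumFields.YangMills.Theorems.Prop7SectET3Transport (periodsT3 bgOfCfg)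
open Summit.QuantumFields.YangMills.Theorems.Prop7SectET3HilbertLetters (W₂ DstarL2 covLapSite)
open Summit.QuantumFields.YangMills.Theorems.Prop7MassiveDivergenceAgmonRow (sq_sum_ball_le_of_massive_divergence)
open Summit.QuantumFields.YangMills.Theorems.Prop7MassiveDivergenceSupDoor (hWsup_of_hHlocV)

/-- ★★★ **`hWsup ⟸ hHlocV`** ([Balaban1985BackgroundPropagators] Thm 3.1 (3.46), sup of `(Δ^η_{U₀} + 1)⁻¹D*_{U₀}x` at a printed-regular background): with the consumer's free reals `Ch θ₀` of the
curved interior η-½-Hölder letter `hHlocV` (px19 g16 text 857ccd79b0071bdc VERBATIM), `0 ≤ Ch`, `0 < θ₀`: `∃ Cw θw, 0 ≤ Cw ∧ 0 < θw ∧ ⟨hWsup Cw θw⟩` (px19 g16 text a03f6c184c689677 VERBATIM)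
— the DOOR ✓`hWsup_of_hHlocV` at `C_A := 9·192³` with `hArow` := cst-p1 g38's ✓`sq_sum_ball_le_of_massive_divergence` (their printed one-line discharge).
[cite: Balaban1985BackgroundPropagators, Thm 3.1 (3.46) p.398, p.399 L1-3; Balaban1984PropagatorsII, Lemma 2.1 (2.61)-(2.63) p.234] -/
theorem hWsup_of_hHlocV_agmon (Ch θ₀ : ℝ) (hCh : 0 ≤ Ch) (hθ₀ : 0 < θ₀)
    (hHlocV : ∀ (F : T3Family) (n K : ℕ) (c₀ : ℝ) [Fact (0 < c₀)] (V : GaugeField (F.P K) 0 (Matrix.specialUnitaryGroup (Fin 2) ℂ))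
      (u q : SiteL2K ℂ 3 (periodsT3 F K) c₀ W₂) (f : BondL2K ℂ 3 (periodsT3 F K) c₀ W₂) (x : TSite 3 (periodsT3 F K)) (Mu Mf Mq δ : ℝ),
      0 ≤ Mu → 0 ≤ Mf → 0 ≤ Mq → 0 ≤ δ → (F.L : ℝ) ^ (K - n) * δ ≤ θ₀ →
      covLapSite F n K c₀ V u + q = DstarL2 F n K c₀ V f →
      (∀ y, tdist (periodsT3 F K) x y ≤ 4 * (F.L : ℝ) ^ (K - n) + 1 → ‖WL2.equiv ℂ (fun _ : TSite 3 (periodsT3 F K) => c₀) W₂ u y‖ ≤ Mu) →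
      (∀ (y : TSite 3 (periodsT3 F K)) (μ : Fin 3), tdist (periodsT3 F K) x y ≤ 4 * (F.L : ℝ) ^ (K - n) + 1 →
        ‖WL2.equiv ℂ (fun _ : Bond 3 (periodsT3 F K) => c₀) W₂ f (y, μ)‖ ≤ Mf) →
      (∀ y, tdist (periodsT3 F K) x y ≤ 4 * (F.L : ℝ) ^ (K - n) + 1 → ‖WL2.equiv ℂ (fun _ : TSite 3 (periodsT3 F K) => c₀) W₂ q y‖ ≤ Mq) →
      (∀ (y : TSite 3 (periodsT3 F K)) (μ : Fin 3), tdist (periodsT3 F K) x y ≤ 4 * (F.L : ℝ) ^ (K - n) + 1 →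
        ‖((bgOfCfg F K V (y, μ) : (Matrix (Fin 2) (Fin 2) ℂ)ˣ) : Matrix (Fin 2) (Fin 2) ℂ) - 1‖ ≤ δ) →
      ∀ x' : TSite 3 (periodsT3 F K), tdist (periodsT3 F K) x x' ≤ (F.L : ℝ) ^ (K - n) →
        ‖WL2.equiv ℂ (fun _ : TSite 3 (periodsT3 F K) => c₀) W₂ u x' - WL2.equiv ℂ (fun _ : TSite 3 (periodsT3 F K) => c₀) W₂ u x‖
          ≤ Ch * (Mu + Mf + Mq) * (tdist (periodsT3 F K) x x' / ((F.L : ℝ) ^ (K - n))) ^ ((1 : ℝ) / 2)) :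
    ∃ Cw θw : ℝ, 0 ≤ Cw ∧ 0 < θw ∧
      ∀ (F : T3Family) (n K : ℕ) (c₀ : ℝ) [Fact (0 < c₀)] (ε₀ : ℝ) (U₀ : GaugeField (F.P K) 0 (Matrix.specialUnitaryGroup (Fin 2) ℂ)),
      0 ≤ ε₀ → ε₀ ≤ θw → RegPr F n K ε₀ U₀ →
      ∀ (w : SiteL2K ℂ 3 (periodsT3 F K) c₀ W₂) (x : BondL2K ℂ 3 (periodsT3 F K) c₀ W₂) (X : ℝ), 0 ≤ X →
      covLapSite F n K c₀ U₀ w + ((1 : ℝ) : ℂ) • w = DstarL2 F n K c₀ U₀ x →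
      (∀ b : Bond 3 (periodsT3 F K), ‖WL2.equiv ℂ (fun _ : Bond 3 (periodsT3 F K) => c₀) W₂ x b‖ ≤ X) →
      ∀ y : TSite 3 (periodsT3 F K), ‖WL2.equiv ℂ (fun _ : TSite 3 (periodsT3 F K) => c₀) W₂ w y‖ ≤ Cw * X :=
  hWsup_of_hHlocV Ch θ₀ (9 * 192 ^ 3) hCh hθ₀ (by norm_num) hHlocV
    (fun F n K c₀ _ V w x X h hx y₀ => sq_sum_ball_le_of_massive_divergence F n K c₀ V w x h hx y₀)

end Summit.QuantumFields.YangMills.Theorems.Prop7MassiveDivergenceSupKnit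

end
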